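import Summits.ResolutionOfSingularities.ResolutionOfSingularities.Theorems.FrobeniusClosingDefs
import Literature.RingTheory.MvPowerSeries.MaximalIdealPow
import Literature.AlgebraicGeometry.Resolution.CobordantArcLemma

/-!
# Crux `ClosingReduction`, line `chart-factorization`: the stub `Factorization`

Sub-goal `stub_factorization : Factorization` of crux `FrobeniusClosing.ClosingReduction`
(stmt-ResolutionOfSingularities-16347): for a field `K`, `n ≥ 1`, a `K`-algebra automorphism `φ` of
`R = K⟦u₁,…,uₙ⟧` and a chart point `(i, τ)` of the blow-up of the closed point there are a chart point
`(i', τ')` and an automorphism `φ'` with `σ_{i',τ'} ∘ φ = φ' ∘ σ_{i,τ}`, where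
`σ_{i,τ} = chartMap n K i τ : u_i ↦ u_i, u_j ↦ u_i (u_j + τ_j)` — the universal property of the point
blow-up, written out in formal coordinates.

Proof (explicit, no geometry). Every `K`-algebra endomorphism of `R` is the substitution of its values
on the variables (`Literature.RingTheory.MvPowerSeries.Jets.algHom_apply_eq_subst`), so `φ` has a linear
part `L s m = coeff (e_m) (φ u_s)`, inverse to the linear part `L'` of `φ.symm`
(`CobordantArc.linMat_mul_of_comp_eq_X`). Put `ε = e_i + Σ_{j ≠ i} τ_j e_j`, `ε' = L' ε ≠ 0`, pick `i'`
with `ε'_{i'} ≠ 0` and `τ' = ε' / ε'_{i'}` (`FactorizationProof.exists_chartPoint`). The CORE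
(`FactorizationProof.exists_intertwiner`): `σ' (φ u_s) = u_{i'} · U_s` (the chart map sends `𝔪` into
`(u_{i'})`), with `U_s(0) = (L ε̃')_s = c · ε_s`, `c ≠ 0`; the substitution
`u_i ↦ u_{i'} U_i`, `u_j ↦ U_j / U_i − τ_j` then intertwines on the generators, hence everywhere
(`algHom_ext_X`). Running the core for `φ.symm` at `(i', τ')` with target `(i, τ)` gives a second
endomorphism; the two composites fix every `σ(u_s)` resp. `σ'(u_s)`, hence are the identity
(`FactorizationProof.eq_id_of_apply_chartMap`, cancelling the non-zero-divisor `u_i`), and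
`AlgEquiv.ofAlgHom` packages `φ'`.
-/

noncomputable section

-- single-problem summit: the doubled namespace component is forced
set_option linter.dupNamespace false

open scoped BigOperators Classical

open MvPowerSeries Literature.RingTheory.MvPowerSeries.Jets

namespace Summit.ResolutionOfSingularities.ResolutionOfSingularities.Theorems.FrobeniusClosing

namespace FactorizationProof

variable {n : ℕ} {K : Type} [Field K]

/-! ### The chart substitution -/

/-- Every entry of the chart substitution has zero constant coefficient. [folklore] -/
theorem constantCoeff_chartSubst (i : Fin n) (τ : Fin n → K) (j : Fin n) :
    constantCoeff (chartSubst n K i τ j) = 0 := by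
  unfold chartSubst
  split_ifs <;> simp [constantCoeff_X]

/-- The chart substitution is substitutable. [folklore] -/
theorem hasSubst_chartSubst (i : Fin n) (τ : Fin n → K) : HasSubst (chartSubst n K i τ) :=
  hasSubst_of_constantCoeff_zero (constantCoeff_chartSubst i τ)

/-- Every entry of the chart substitution is `u_i` times `1` resp. `u_j + τ_j`. [folklore] -/
theorem chartSubst_eq_X_mul (i : Fin n) (τ : Fin n → K) (j : Fin n) :
    chartSubst n K i τ j = X i * (if j = i then 1 else (X j + C (τ j))) := by
  unfold chartSubst
  split_ifs <;> simp

/-- `σ_{i,τ}(u_i) = u_i`. [folklore] -/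
theorem chartMap_X_self (i : Fin n) (τ : Fin n → K) : chartMap n K i τ (X i) = X i := by
  unfold chartMap
  rw [subst_X (hasSubst_chartSubst i τ)]
  simp [chartSubst]

/-- `σ_{i,τ}(u_j) = u_i (u_j + τ_j)` for `j ≠ i`. [folklore] -/
theorem chartMap_X_of_ne (i : Fin n) (τ : Fin n → K) {j : Fin n} (hj : j ≠ i) :
    chartMap n K i τ (X j) = X i * (X j + C (τ j)) := by
  unfold chartMap
  rw [subst_X (hasSubst_chartSubst i τ)]
  simp [chartSubst, hj]

/-- The chart map sends the maximal ideal into the ideal `(u_i)` of the exceptional divisor.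
[folklore] -/
theorem X_dvd_chartMap (i : Fin n) (τ : Fin n → K) {g : MvPowerSeries (Fin n) K}
    (hg : constantCoeff g = 0) : X i ∣ chartMap n K i τ g := by
  obtain ⟨S, G, hS, rfl⟩ := exists_eq_sum_monomial_mul 1 g (fun e he => by
    have he0 : e = 0 := (Finsupp.degree_eq_zero_iff e).1 (by omega)
    subst he0
    rw [coeff_zero_eq_constantCoeff_apply]
    exact hg)
  unfold chartMap
  rw [← coe_substAlgHom (hasSubst_chartSubst i τ), map_sum]
  refine Finset.dvd_sum fun e he => ?_
  rw [map_mul]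
  refine Dvd.dvd.mul_right ?_ _
  obtain ⟨s, rfl⟩ : ∃ s, e = Finsupp.single s 1 := by
    rcases Literature.AlgebraicGeometry.Resolution.FormalCoordChange.eq_zero_or_single_of_degree_lt_two
        e (by rw [hS e he]; norm_num) with h | h
    · have := hS e he
      rw [h] at this
      simp at this
    · exact h
  rw [← X_def, substAlgHom_X, chartSubst_eq_X_mul]
  exact dvd_mul_right _ _

/-- The coefficient of `u_i` in `u_i · U` is the constant coefficient of `U`. [folklore] -/
theorem coeff_single_X_mul (i : Fin n) (U : MvPowerSeries (Fin n) K) :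
    coeff (Finsupp.single i 1) (X i * U) = constantCoeff U := by
  rw [X_def, coeff_monomial_mul, if_pos le_rfl, one_mul, tsub_self, coeff_zero_eq_constantCoeff_apply]

/-- The coefficient of `u_i` in the entries of the chart substitution: the point
`ε̃ = e_i + Σ_{j ≠ i} τ_j e_j`. [folklore] -/
theorem coeff_single_chartSubst (i : Fin n) (τ : Fin n → K) (m : Fin n) :
    coeff (Finsupp.single i 1) (chartSubst n K i τ m) = if m = i then 1 else τ m := by
  rw [chartSubst_eq_X_mul, coeff_single_X_mul]
  split_ifs <;> simp [constantCoeff_X]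

/-- FIRST-ORDER PART of the chart map: the coefficient of `u_i` in `σ_{i,τ}(g)` is the linear part
of `g` evaluated at the point `ε̃`. [folklore] -/
theorem coeff_single_chartMap (i : Fin n) (τ : Fin n → K) (g : MvPowerSeries (Fin n) K) :
    coeff (Finsupp.single i 1) (chartMap n K i τ g) =
      ∑ m, coeff (Finsupp.single m 1) g * (if m = i then 1 else τ m) := by
  unfold chartMap
  rw [Literature.AlgebraicGeometry.Resolution.CobordantArc.coeff_degree_one_subst _
    (constantCoeff_chartSubst i τ) g _ (Finsupp.degree_single _ _)]
  simp_rw [coeff_single_chartSubst]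

/-! ### The core: an intertwining endomorphism -/

/-- **Core construction.** Let `χ` be a `K`-algebra endomorphism of `K⟦u⟧`, `(i, τ)` and `(i', τ')`
chart points and `c ≠ 0` with `L ε̃' = c · ε̃` for the linear part `L` of `χ` (`ε̃ = e_i + Σ τ_j e_j`,
`ε̃' = e_{i'} + Σ τ'_m e_m`). Then `σ_{i',τ'} ∘ χ = ρ ∘ σ_{i,τ}` for an endomorphism `ρ`: writing
`σ'(χ u_s) = u_{i'} U_s` (`U_s(0) = c ε̃_s`, so `U_i` is a unit and `U_j(0)/U_i(0) = τ_j`), `ρ` is the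
substitution `u_i ↦ u_{i'} U_i`, `u_j ↦ U_j U_i⁻¹ − τ_j`. [folklore] -/
theorem exists_intertwiner (χ : MvPowerSeries (Fin n) K →ₐ[K] MvPowerSeries (Fin n) K)
    (i i' : Fin n) (τ τ' : Fin n → K) (c : K) (hc : c ≠ 0)
    (H : ∀ s, ∑ m, coeff (Finsupp.single m 1) (χ (X s)) * (if m = i' then 1 else τ' m) =
      c * (if s = i then 1 else τ s)) :
    ∃ ρ : MvPowerSeries (Fin n) K →ₐ[K] MvPowerSeries (Fin n) K,
      ∀ f, chartMap n K i' τ' (χ f) = ρ (chartMap n K i τ f) := by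
  -- the quotients `U s`: `σ' (χ u_s) = u_{i'} · U s`
  have hdvd : ∀ s, ∃ U, chartMap n K i' τ' (χ (X s)) = X i' * U := fun s =>
    X_dvd_chartMap i' τ' (constantCoeff_algHom_X χ s)
  choose U hU using hdvd
  have hU0 : ∀ s, constantCoeff (U s) = c * (if s = i then 1 else τ s) := fun s => by
    rw [← coeff_single_X_mul i' (U s), ← hU, coeff_single_chartMap, H]
  have hUi : constantCoeff (U i) = c := by rw [hU0, if_pos rfl, mul_one]
  -- `U i` is a unit with inverse `V`
  obtain ⟨V, hV⟩ : ∃ V, U i * V = 1 := by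
    have hu : IsUnit (U i) := by
      rw [isUnit_iff_constantCoeff, hUi, isUnit_iff_ne_zero]
      exact hc
    exact hu.exists_right_inv
  have hV0 : constantCoeff V = c⁻¹ := by
    have h1 := congrArg constantCoeff hV
    rw [map_mul, map_one, hUi] at h1
    exact eq_inv_of_mul_eq_one_right h1
  -- the substitution `ψ`
  obtain ⟨ψ, hψi, hψj⟩ : ∃ ψ : Fin n → MvPowerSeries (Fin n) K,
      ψ i = X i' * U i ∧ ∀ s, s ≠ i → ψ s = U s * V - C (τ s) :=
    ⟨fun s => if s = i then X i' * U i else U s * V - C (τ s), by simp, fun s hs => by simp [hs]⟩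
  have hψ0 : ∀ s, constantCoeff (ψ s) = 0 := by
    intro s
    by_cases hs : s = i
    · rw [hs, hψi, map_mul, constantCoeff_X, zero_mul]
    · rw [hψj s hs, map_sub, map_mul, hU0, if_neg hs, hV0, constantCoeff_C, mul_comm c, mul_assoc,
        mul_inv_cancel₀ hc, mul_one, sub_self]
  have hψ : HasSubst ψ := hasSubst_of_constantCoeff_zero hψ0
  refine ⟨substAlgHom hψ, ?_⟩
  -- the two composites agree on the variables
  have key : (substAlgHom (hasSubst_chartSubst i' τ')).comp χ =
      (substAlgHom hψ).comp (substAlgHom (hasSubst_chartSubst i τ)) := by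
    apply algHom_ext_X
    intro s
    rw [AlgHom.comp_apply, AlgHom.comp_apply, substAlgHom_apply, substAlgHom_X]
    change chartMap n K i' τ' (χ (X s)) = _
    rw [hU s]
    by_cases hs : s = i
    · subst hs
      rw [chartSubst_eq_X_mul, if_pos rfl, mul_one, substAlgHom_X, hψi]
    · rw [chartSubst_eq_X_mul, if_neg hs, map_mul, map_add, substAlgHom_X, substAlgHom_X, algHom_C,
        hψi, hψj s hs]
      symm
      calc X i' * U i * (U s * V - C (τ s) + C (τ s)) = X i' * U s * (U i * V) := by ring
        _ = X i' * U s := by rw [hV, mul_one]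
  intro f
  have hf := AlgHom.congr_fun key f
  simp only [AlgHom.coe_comp, Function.comp_apply, substAlgHom_apply] at hf
  simp only [chartMap, substAlgHom_apply]
  exact hf

/-- An endomorphism fixing every `σ_{i,τ}(f)` is the identity (it fixes `u_i` and
`u_i (ω u_j + τ_j) = u_i (u_j + τ_j)`; cancel the non-zero-divisor `u_i`). [folklore] -/
theorem eq_id_of_apply_chartMap (ω : MvPowerSeries (Fin n) K →ₐ[K] MvPowerSeries (Fin n) K)
    (i : Fin n) (τ : Fin n → K) (h : ∀ f, ω (chartMap n K i τ f) = chartMap n K i τ f) :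
    ω = AlgHom.id K (MvPowerSeries (Fin n) K) := by
  apply algHom_ext_X
  intro s
  rw [AlgHom.id_apply]
  have hi : ω (X i) = X i := by
    have := h (X i)
    rwa [chartMap_X_self] at this
  by_cases hs : s = i
  · rw [hs]
    exact hi
  · have hs' := h (X s)
    rw [chartMap_X_of_ne i τ hs, map_mul, map_add, hi, algHom_C] at hs'
    exact add_right_cancel (mul_left_cancel₀
      (Literature.AlgebraicGeometry.Resolution.FormalCoordChange.X_ne_zero' i) hs')

/-! ### Linear algebra: the chart point `(i', τ')` -/

/-- Choice of the new chart point: for `L L' = 1` and `ε_i ≠ 0`, with `ε' = L' ε` pick `i'` with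
`ε'_{i'} ≠ 0` and `τ' = ε' / ε'_{i'}`; then `L ε̃' = ε / ε'_{i'}` and `L' ε = ε'_{i'} · ε̃'`
(`ε̃' = e_{i'} + Σ τ'_m e_m = ε' / ε'_{i'}`). [folklore] -/
theorem exists_chartPoint {L L' : Matrix (Fin n) (Fin n) K} (hLL' : L * L' = 1) (ε : Fin n → K)
    {i : Fin n} (hεi : ε i ≠ 0) :
    ∃ (i' : Fin n) (τ' : Fin n → K), Matrix.mulVec L' ε i' ≠ 0 ∧
      (∀ s, ∑ m, L s m * (if m = i' then 1 else τ' m) = (Matrix.mulVec L' ε i')⁻¹ * ε s) ∧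
      (∀ s, ∑ m, L' s m * ε m = Matrix.mulVec L' ε i' * (if s = i' then 1 else τ' s)) := by
  set ε' := Matrix.mulVec L' ε with hε'
  have hLε' : Matrix.mulVec L ε' = ε := by
    rw [hε', Matrix.mulVec_mulVec, hLL', Matrix.one_mulVec]
  obtain ⟨i', hi'⟩ : ∃ i', ε' i' ≠ 0 := by
    by_contra hcon
    push Not at hcon
    apply hεi
    have h0 : ε' = 0 := funext hcon
    rw [← hLε', h0, Matrix.mulVec_zero, Pi.zero_apply]
  have hsum : ∀ s, ∑ m, L s m * ε' m = ε s := fun s => by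
    have := congrFun hLε' s
    simpa only [Matrix.mulVec, dotProduct] using this
  have hsum' : ∀ s, ∑ m, L' s m * ε m = ε' s := fun s => by
    simp only [hε', Matrix.mulVec, dotProduct]
  refine ⟨i', fun m => ε' m / ε' i', hi', fun s => ?_, fun s => ?_⟩
  · have h1 : ∀ m, (if m = i' then (1 : K) else ε' m / ε' i') = ε' m / ε' i' := fun m => by
      split_ifs with hm
      · rw [hm, div_self hi']
      · rfl
    simp_rw [h1, mul_div_assoc', ← Finset.sum_div, hsum s, div_eq_inv_mul]
  · rw [hsum' s]
    split_ifs with hs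
    · rw [hs, mul_one]
    · rw [mul_comm, div_mul_cancel₀ _ hi']

end FactorizationProof

open FactorizationProof in
/-- **Chart factorization** (`Factorization`, sub-goal `stub_factorization` of line
`chart-factorization` of crux `ClosingReduction`): for every field `K`, `n ≥ 1`, every `K`-algebra
automorphism `φ` of `K⟦u₁,…,uₙ⟧` and every chart point `(i, τ)` of the blow-up of the closed point
there are a chart point `(i', τ')` and an automorphism `φ'` with `σ_{i',τ'} ∘ φ = φ' ∘ σ_{i,τ}` — the
universal property of the point blow-up in formal coordinates: `(i', τ')` is the chart of the point
`L⁻¹ ε` (`L` the linear part of `φ`, `ε = e_i + Σ τ_j e_j`), `φ'` the core intertwiner, its inverse the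
core intertwiner of `φ.symm`. [folklore] -/
theorem stub_factorization : Factorization := by
  intro n _ K _ φ i τ
  -- every endomorphism is a substitution; linear parts of `φ` and `φ.symm` are mutually inverse
  have eφ' : ∀ f, φ.symm f = subst (fun m => φ.symm (X m)) f := fun f =>
    algHom_apply_eq_subst (φ.symm : MvPowerSeries (Fin n) K →ₐ[K] MvPowerSeries (Fin n) K) f
  have h0' : ∀ s, constantCoeff (φ.symm (X s)) = 0 := fun s =>
    constantCoeff_algHom_X (φ.symm : MvPowerSeries (Fin n) K →ₐ[K] MvPowerSeries (Fin n) K) s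
  have hLL' : (Matrix.of fun s m => coeff (Finsupp.single m 1) (φ (X s))) *
      (Matrix.of fun m j => coeff (Finsupp.single j 1) (φ.symm (X m))) = 1 :=
    Literature.AlgebraicGeometry.Resolution.CobordantArc.linMat_mul_of_comp_eq_X h0' (fun s => by
      rw [← eφ']
      exact φ.symm_apply_apply (X s))
  -- the new chart point
  obtain ⟨i', τ', hne, H1, H2⟩ :=
    exists_chartPoint hLL' (fun s => if s = i then (1 : K) else τ s) (i := i) (by simp)
  simp only [Matrix.of_apply] at H1 H2
  -- the two core intertwiners
  obtain ⟨ρ, hρ⟩ := exists_intertwiner (φ : MvPowerSeries (Fin n) K →ₐ[K] MvPowerSeries (Fin n) K)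
    i i' τ τ' _ (inv_ne_zero hne) H1
  obtain ⟨ρ', hρ'⟩ :=
    exists_intertwiner (φ.symm : MvPowerSeries (Fin n) K →ₐ[K] MvPowerSeries (Fin n) K)
      i' i τ' τ _ hne H2
  have hρ1 : ∀ f, chartMap n K i' τ' (φ f) = ρ (chartMap n K i τ f) := fun f => hρ f
  have hρ2 : ∀ f, chartMap n K i τ (φ.symm f) = ρ' (chartMap n K i' τ' f) := fun f => hρ' f
  -- they are mutually inverse
  have h1 : ρ.comp ρ' = AlgHom.id K (MvPowerSeries (Fin n) K) :=
    eq_id_of_apply_chartMap _ i' τ' fun f => by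
      rw [AlgHom.comp_apply, ← hρ2, ← hρ1, AlgEquiv.apply_symm_apply]
  have h2 : ρ'.comp ρ = AlgHom.id K (MvPowerSeries (Fin n) K) :=
    eq_id_of_apply_chartMap _ i τ fun f => by
      rw [AlgHom.comp_apply, ← hρ1, ← hρ2, AlgEquiv.symm_apply_apply]
  exact ⟨i', τ', AlgEquiv.ofAlgHom ρ ρ' h1 h2, fun f => hρ1 f⟩

end Summit.ResolutionOfSingularities.ResolutionOfSingularities.Theorems.FrobeniusClosing

end
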